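import Literature.AlgebraicGeometry.HodgeTheory.HodgeGenericQbarDescent
import Literature.AlgebraicGeometry.HodgeTheory.HodgeStructureOfHodgeModel
import Literature.AlgebraicGeometry.HodgeTheory.ComplexConjugationHolds
import Literature.AlgebraicGeometry.HodgeTheory.RationalLattice
import Literature.AlgebraicGeometry.Motives.MumfordTateRankInvariance
import HarnessLib

/-!
# Hodge-genericity on real carriers, and the BKU fact from its real-carrier form

Family `hodge`, layer `Literature/AlgebraicGeometry/HodgeTheory` (fact seat of
`bku_finite_monodromyOrbit_of_isHodgeGenericIn`). The named fact
`bku_finite_monodromyOrbit_of_isHodgeGenericIn` (`HodgeGenericQbarDescent.lean`; Baldi–Klingler–Ullmo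
§3.2 with Klingler–Otwinowska–Urbanik §1.1.1: at a Hodge-generic point every Hodge class has finite
monodromy orbit) is phrased through a CLASSICAL Betti–Hodge datum `B` (`BettiHodgeData.IsClassical`)
and a geometric VHS datum `D : GeometricVHSData B f n (2p)`: Hodge-genericity of `s` is
`D.IsHodgeGenericIn univ s`, maximality at `s` of `dim MT(D.hodge t)`. Its conclusion (finiteness of
the set of flat continuations of a rational `(p,p)` class along loops) lives on the tree's real
carriers and does not mention `B` or `D`. The route `PeriodDeficiency` meanwhile uses the same
statement ON REAL CARRIERS (hypothesis `hBr` of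
`Summit.HodgeConjecture.….hodgeConjecture_of_realCarrier_genericity`): Hodge-genericity as maximality
of `dim MT` of the `ℚ`-Hodge structures `(A t).hodgeStructure` of `H²ᵖ(𝒳_t(ℂ); ℚ)` read through
Hodge-symmetric Hodge models `A t` of the fibres (`HodgeStructureOfHodgeModel`). This file PROVES that
the two genericity notions agree and that **the named fact follows from its real-carrier form**:

* `BettiHodgeData.hodgeModelComparison_eq_comp` — `Φ_A = Θ_A ∘ (B.iso)_ℂ`: the comparison map of a
  Betti–Hodge datum factors through the complexification isomorphism of the Hodge model;
* `BettiHodgeData.IsClassical.hodge_eq_comapEquiv_hodgeStructure` — for `B` classical,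
  **`B.hodge hX i = (A.hodgeStructure hX hA i).comapEquiv (B.isoObj X i)`**: `B.hodge` IS the Hodge
  structure of `Hⁱ(X(ℂ); ℚ)` (Voisin I §7.1.1), transported along `B.iso` (clause (i') of
  `IsClassical`, in all filtration degrees `r ∈ ℤ`); hence `IsClassical.mtRank_hodge_eq` —
  `dim MT(B.hodge hX i) = dim MT((A.hodgeStructure hX hA i))` (`HodgeStructure.mtRank_comapEquiv`,
  `Motives/MumfordTateRankInvariance`);
* `GeometricVHSData.mtRankAt_eq_mtRank_hodgeStructure`,
  `GeometricVHSData.isHodgeGenericIn_iff_hodgeStructure` — for `D` over a classical `B`,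
  `D.mtRankAt s` is the Mumford–Tate rank of the Hodge structure of `Hⁱ(𝒳_s(ℂ); ℚ)`, and
  `D.IsHodgeGenericIn Y s` is its maximality at `s` on `Y`, for ANY Hodge-symmetric models;
* `bku_finite_monodromyOrbit_of_isHodgeGenericIn_of_realCarrier` — **the named fact from `hBr`**
  (Hodge-symmetric models exist, `exists_isReal_hodgeModel_holds`; `H²ᵖ(𝒳_t(ℂ); ℚ)` is finite
  dimensional, `finite_singularCohomology_rat_complexPoints`).

So a proof of the BKU statement on real carriers discharges the named fact as well; what such a
proof needs (the holomorphic variation of the Hodge filtration, analyticity of Hodge loci, a flat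
definite polarization, the comparison of Mumford–Tate groups along parallel transport — Deligne,
Hodge II 7.5; André 1992 §5; Cattani–Deligne–Kaplan 1995) is not in the tree. Everything here is a
theorem; no definition and no named fact is introduced.

## References

* [BaldiKlinglerUllmo2024] G. Baldi, B. Klingler, E. Ullmo, On the distribution of the Hodge locus,
  Invent. Math. 235 (2024), §3.2.
* [KlinglerOtwinowskaUrbanik2023] B. Klingler, A. Otwinowska, D. Urbanik, On the fields of definition
  of Hodge loci, Ann. Sci. ÉNS 56 (2023), §1.1.1.
* [VoisinHodgeI2002] C. Voisin, Hodge Theory and Complex Algebraic Geometry I, CUP 2002, §7.1.1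
  Def. 7.4 and Prop. 7.5.
* [Deligne1982HodgeCycles] P. Deligne, Hodge cycles on abelian varieties, LNM 900 (1982), I §3.
-/

noncomputable section

open CategoryTheory AlgebraicGeometry
open _root_.Topology
open scoped TensorProduct
open Literature.AlgebraicGeometry.Motives Literature.AlgebraicTopology.SingularHomology

namespace Literature.AlgebraicGeometry.HodgeTheory

section HodgeTheory

/-! ### `B.hodge` is the Hodge structure of a Hodge model, transported along `B.iso` -/

section Classical

variable {B : BettiHodgeData ℂ} {n : ℕ} {X : SchemeOver ℂ}

/-- The comparison `Φ_A : ℂ ⊗ Hⁱ(X) → Hⁱ(X^an; ℂ)` of a Betti–Hodge datum factors as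
`Θ_A ∘ (B.iso)_ℂ` through the complexification isomorphism `Θ_A : ℂ ⊗ Hⁱ(X(ℂ); ℚ) ≅ Hⁱ(X^an; ℂ)` of
the Hodge model (both are "`c ⊗ v ↦ c • φ^*(v ⊗ 1)`"). [folklore] -/
theorem _root_.Literature.AlgebraicGeometry.Motives.BettiHodgeData.hodgeModelComparison_eq_comp
    (hX : IsSmoothProjective n X) (A : HodgeModel n X) (i : ℕ) :
    B.hodgeModelComparison A i =
      (A.complexification hX i).toLinearMap ∘ₗ (B.isoObj X i).toLinearMap.baseChange ℂ := by
  refine LinearMap.ext fun x ↦ ?_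
  induction x using TensorProduct.induction_on with
  | zero => simp
  | add x y hx hy => simp only [map_add, hx, hy]
  | tmul c v =>
    rw [BettiHodgeData.hodgeModelComparison_tmul, LinearMap.comp_apply, LinearMap.baseChange_tmul,
      LinearEquiv.coe_coe, LinearEquiv.coe_coe, HodgeModel.complexification_apply,
      ofRatClassBaseChange_tmul, map_smul]

/-- **For a classical Betti–Hodge datum, `B.hodge` IS the Hodge structure of the fibre on real
carriers**: for `X` smooth projective, a Hodge-symmetric Hodge model `A` of `X` and every `i`,
`B.hodge hX i` is the `ℚ`-Hodge structure `A.hodgeStructure hX hA i` on `Hⁱ(X(ℂ); ℚ)`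
(`HodgeStructureOfHodgeModel`, Voisin I §7.1.1) transported along `B.iso : Hⁱ(X) ≃ Hⁱ(X(ℂ); ℚ)` —
clause (i') of `BettiHodgeData.IsClassical` read through `hodgeModelComparison_eq_comp`.
[cite: VoisinHodgeI2002, §7.1.1 Def. 7.4 and Prop. 7.5] -/
theorem _root_.Literature.AlgebraicGeometry.Motives.BettiHodgeData.IsClassical.hodge_eq_comapEquiv_hodgeStructure
    (h : B.IsClassical) (hX : IsSmoothProjective n X) (A : HodgeModel n X) (hA : A.IsHodgeSymmetric)
    (i : ℕ) : B.hodge hX i = (A.hodgeStructure hX hA i).comapEquiv (B.isoObj X i) := by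
  refine HodgeStructure.ext (funext fun r ↦ ?_)
  rw [HodgeStructure.comapEquiv_F, HodgeModel.hodgeStructure_F]
  rcases le_or_gt 0 r with hr | hr
  · obtain ⟨m, rfl⟩ := Int.eq_ofNat_of_zero_le hr
    rw [← h.comap_hodgeFiltration hX A i m, BettiHodgeData.hodgeModelComparison_eq_comp hX A i,
      Submodule.comap_comp]
    rfl
  · rw [A.ratF_of_nonpos hX i hr.le, Submodule.comap_top]
    refine eq_top_iff.2 (le_trans ?_ ((B.hodge hX i).antitone_F hr.le))
    rw [← Int.ofNat_zero, ← h.comap_hodgeFiltration hX A i 0, A.hodgeFiltration_zero,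
      Submodule.comap_top]

variable [HodgeTensorFacts.{0, 0}]

/-- **The Mumford–Tate rank of `B.hodge` is that of the Hodge structure on real carriers**, for a
classical `B` (`hodge_eq_comapEquiv_hodgeStructure` and `HodgeStructure.mtRank_comapEquiv`).
[cite: BaldiKlinglerUllmo2024, §3.2] -/
theorem _root_.Literature.AlgebraicGeometry.Motives.BettiHodgeData.IsClassical.mtRank_hodge_eq
    (h : B.IsClassical) (hX : IsSmoothProjective n X) (A : HodgeModel n X) (hA : A.IsHodgeSymmetric)
    (i : ℕ) [Module.Finite ℚ (B.W.obj X i)]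
    [Module.Finite ℚ (singularCohomology ℚ ℚ (ComplexPoints X) i)] :
    (B.hodge hX i).mtRank = (A.hodgeStructure hX hA i).mtRank := by
  rw [h.hodge_eq_comapEquiv_hodgeStructure hX A hA i, HodgeStructure.mtRank_comapEquiv]

end Classical

/-! ### Hodge-genericity of a geometric VHS datum, on real carriers -/

section Geometric

variable [HodgeTensorFacts.{0, 0}] {B : BettiHodgeData ℂ} {𝒳 S : SchemeOver ℂ} {f : 𝒳 ⟶ S}
  {n i : ℕ}

/-- **The Mumford–Tate rank of a geometric VHS datum over a classical `B` at `s` is the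
Mumford–Tate rank of the Hodge structure of `Hⁱ(𝒳_s(ℂ); ℚ)`** read through any Hodge-symmetric
Hodge model of the fibre. [cite: BaldiKlinglerUllmo2024, §3.2] -/
theorem _root_.Literature.AlgebraicGeometry.Motives.GeometricVHSData.mtRankAt_eq_mtRank_hodgeStructure
    (hB : B.IsClassical) (D : GeometricVHSData B f n i) [∀ t : ComplexPoints S, Module.Finite ℚ (D.V.fiber t)]
    {s : ComplexPoints S} (A : HodgeModel n (fiberOver f s)) (hA : A.IsHodgeSymmetric)
    [Module.Finite ℚ (singularCohomology ℚ ℚ (ComplexPoints (fiberOver f s)) i)] :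
    D.mtRankAt s = (A.hodgeStructure (D.isSmoothProjective_fiberOver s) hA i).mtRank := by
  haveI := D.finite_W_fiberOver s
  rw [D.mtRankAt_eq_mtRank_hodge s]
  exact hB.mtRank_hodge_eq _ A hA i

/-- **Hodge-genericity of a geometric VHS datum over a classical `B` is Hodge-genericity on real
carriers**: for any choice of Hodge-symmetric Hodge models `A t` of the fibres, `s` is Hodge-generic
in `Y` for `D` iff `s ∈ Y` and `dim MT` of the Hodge structure of `Hⁱ(𝒳_y(ℂ); ℚ)` is maximal at
`y = s` on `Y`. [cite: BaldiKlinglerUllmo2024, §3.2] -/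
theorem _root_.Literature.AlgebraicGeometry.Motives.GeometricVHSData.isHodgeGenericIn_iff_hodgeStructure
    (hB : B.IsClassical) (D : GeometricVHSData B f n i) [∀ t : ComplexPoints S, Module.Finite ℚ (D.V.fiber t)]
    (A : ∀ t : ComplexPoints S, HodgeModel n (fiberOver f t)) (hA : ∀ t, (A t).IsHodgeSymmetric)
    [∀ t, Module.Finite ℚ (singularCohomology ℚ ℚ (ComplexPoints (fiberOver f t)) i)]
    (Y : Set (ComplexPoints S)) (s : ComplexPoints S) :
    D.IsHodgeGenericIn Y s ↔ s ∈ Y ∧ ∀ y ∈ Y,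
      ((A y).hodgeStructure (D.isSmoothProjective_fiberOver y) (hA y) i).mtRank ≤
        ((A s).hodgeStructure (D.isSmoothProjective_fiberOver s) (hA s) i).mtRank := by
  simp only [VHSData.IsHodgeGenericIn, D.mtRankAt_eq_mtRank_hodgeStructure hB (A _) (hA _)]

end Geometric

/-! ### The named fact from its real-carrier form -/

/-- **`bku_finite_monodromyOrbit_of_isHodgeGenericIn` follows from its real-carrier form.** The
hypothesis `hBr` is the statement "at a point `s` of `S(ℂ)` where the Mumford–Tate rank of the Hodge
structure of `H²ᵖ(𝒳_t(ℂ); ℚ)` — read through Hodge-symmetric Hodge models `A t` of the fibres,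
`HodgeModel.hodgeStructure` — is maximal, every rational `(p,p)` class has finite monodromy orbit"
(Baldi–Klingler–Ullmo §3.2 with Klingler–Otwinowska–Urbanik §1.1.1, ON THE TREE'S REAL CARRIERS; the
shape used by the route `PeriodDeficiency` over real carriers). Given it, the named fact (phrased
through a classical Betti–Hodge datum `B` and a geometric VHS datum `D`) holds: Hodge-symmetric models
of the fibres exist (`exists_isReal_hodgeModel_holds`), `H²ᵖ(𝒳_t(ℂ); ℚ)` is finite dimensional
(`finite_singularCohomology_rat_complexPoints`), and Hodge-genericity for `D` is maximality of that
Mumford–Tate rank (`GeometricVHSData.isHodgeGenericIn_iff_hodgeStructure`: `D.hodge t` is `B.hodge`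
transported along `fiberIso t`, `B.hodge` is the model's Hodge structure transported along `B.iso`,
and the Mumford–Tate rank is invariant under transport, `HodgeStructure.mtRank_comapEquiv`).
[cite: BaldiKlinglerUllmo2024, §3.2] [cite: KlinglerOtwinowskaUrbanik2023, §1.1.1] -/
theorem bku_finite_monodromyOrbit_of_isHodgeGenericIn_of_realCarrier
    (hBr : ∀ [HodgeTensorFacts.{0, 0}] (σ : AlgebraicClosure ℚ →+* ℂ)
      ⦃𝒳₀ S₀ : SchemeOver (AlgebraicClosure ℚ)⦄ (f₀ : 𝒳₀ ⟶ S₀) (n p : ℕ)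
      (hf : IsSmoothProjectiveFamily ((baseChangeHom σ).map f₀) n),
      IsQuasiProjectiveOver 𝒳₀ → IsQuasiProjectiveOver S₀ → IrreducibleSpace S₀.left →
      AlgebraicGeometry.Smooth S₀.hom →
      ∀ (A : ∀ t : ComplexPoints ((baseChangeHom σ).obj S₀),
          HodgeModel n (fiberOver ((baseChangeHom σ).map f₀) t))
        (hA : ∀ t, (A t).IsHodgeSymmetric)
        [∀ t, Module.Finite ℚ
          (singularCohomology ℚ ℚ (ComplexPoints (fiberOver ((baseChangeHom σ).map f₀) t)) (2 * p))]
        (s : ComplexPoints ((baseChangeHom σ).obj S₀)),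
        (∀ t, ((A t).hodgeStructure (hf.isSmoothProjective t) (hA t) (2 * p)).mtRank ≤
            ((A s).hodgeStructure (hf.isSmoothProjective s) (hA s) (2 * p)).mtRank) →
        ∀ (α : complexBetti (fiberOver ((baseChangeHom σ).map f₀) s) (2 * p)),
          IsRationalClass α →
          IsOfHodgeType n (fiberOver ((baseChangeHom σ).map f₀) s) (2 * p) p p α →
            {β : complexBetti (fiberOver ((baseChangeHom σ).map f₀) s) (2 * p) |
                ∃ γ : Path s s, IsContinuationAlong γ α β}.Finite) :
    bku_finite_monodromyOrbit_of_isHodgeGenericIn := by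
  intro B hB _ σ 𝒳₀ S₀ f₀ n p D _ h𝒳₀ hS₀ hirr hsm s hs α hαr hαh
  have hf := D.isSmoothProjectiveFamily
  choose A hA using fun t : ComplexPoints ((baseChangeHom σ).obj S₀) ↦
    exists_isReal_hodgeModel_holds.exists_isHodgeSymmetric (hf.isSmoothProjective t)
  haveI : ∀ t : ComplexPoints ((baseChangeHom σ).obj S₀), Module.Finite ℚ
      (singularCohomology ℚ ℚ (ComplexPoints (fiberOver ((baseChangeHom σ).map f₀) t)) (2 * p)) :=
    fun t ↦ finite_singularCohomology_rat_complexPoints (hf.isSmoothProjective t) (2 * p)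
  refine hBr σ f₀ n p hf h𝒳₀ hS₀ hirr hsm A hA s (fun t ↦ ?_) α hαr hαh
  have ht := hs.2 t (Set.mem_univ t)
  rwa [D.mtRankAt_eq_mtRank_hodgeStructure hB (A t) (hA t),
    D.mtRankAt_eq_mtRank_hodgeStructure hB (A s) (hA s)] at ht

end HodgeTheory

end Literature.AlgebraicGeometry.HodgeTheory

end
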